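import Summits.FinalStateConjecture.FinalStateConjecture.Theorems.LogTimeThreeAnnuliDyadicCaptureFreezingA
import Summits.FinalStateConjecture.FinalStateConjecture.Theorems.LogTimeThreeAnnuliDyadicCaptureKerrSchildJets

/-!
# Route LogTimeThreeAnnuli · crux `DyadicCapture` · line `registered` — freezing assembly, part B

The ANCHOR and the DISC EXCLUSION of `stub_freezingAssembly`: `freezing_exists_anchor` (a rest-frame
shell point `y₀ = (0,0,s,s)` of the reference exterior; at `x₀ = c + Λy₀` the family `p ↦ g_p(x₀)` is
injective on `{M > 0}` and continuous, `stub_kerrSchildRigidity` (i)–(ii) boosted, so window sequences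
whose anchor images converge do converge, `freezing_tendsto_of_tendsto_anchor`);
`freezing_enorm_anchor_sub_le` (at `x₀ + τΛe₀` two members differ by at most the two deviations —
values, stationarity); `freezing_sq_le_of_truncDeviationCk_ne_top` (a member with finite `C⁰` distance
on a reference slab of radius `ρ ≥ |a| + 1` has `a² ≤ a'² + max(r₊',0)²`: otherwise its ring lies in
the reference exterior, where `Ψ^*g` is continuous while `H = M/r → ∞`, `stub_kerrSchildRigidity` (iii)).
Sources: Kerr–Schild 1965 §2; Visser arXiv:0706.0622 (33)–(35); DHRT arXiv:2104.08222 §1.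
-/

-- the `Summit.FinalStateConjecture.FinalStateConjecture.…` namespace repeats the summit = sub-problem
-- segment (D-0017 layout, CONVENTIONS §2); the duplicate is deliberate.
set_option linter.dupNamespace false

noncomputable section

namespace Summit.FinalStateConjecture.FinalStateConjecture.Theorems

open Literature.Geometry.Lorentzian
open scoped Topology Manifold ENNReal ContDiff
open Filter Set

/-! ### The anchor -/

section Anchor

variable (Λ : lorentzGroup) (c : E4) (M' a' : ℝ)

/-- **An anchor exists**: a rest-frame point `y₀ = (0, 0, s, s)` (`s = |a'| + max(r₊',0) + 1`) of the
reference exterior, off the axis and off the equatorial plane, so that `r_α(y₀) > 0` for every `α`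
and the rigidity lemma applies at `y₀`. [folklore] -/
theorem freezing_exists_anchor :
    ∃ y₀ : E4, y₀ 0 = 0 ∧ y₀ 1 = 0 ∧ y₀ 2 ≠ 0 ∧ y₀ 3 ≠ 0 ∧
      max (Kerr.rPlus M' a') 0 < Kerr.radius a' y₀ := by
  set s : ℝ := |a'| + max (Kerr.rPlus M' a') 0 + 1 with hs
  have hm0 : 0 ≤ max (Kerr.rPlus M' a') 0 := le_max_right _ _
  have hs0 : 0 < s := by positivity
  refine ⟨s • (EuclideanSpace.single (2 : Fin 4) (1 : ℝ) + EuclideanSpace.single (3 : Fin 4) (1 : ℝ)),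
    by simp, by simp, by simp [hs0.ne'], by simp [hs0.ne'], ?_⟩
  set y₀ : E4 := s • (EuclideanSpace.single (2 : Fin 4) (1 : ℝ) + EuclideanSpace.single (3 : Fin 4) (1 : ℝ))
  have hsq : E4.spatialNorm y₀ ^ 2 = 2 * s ^ 2 := by
    rw [E4.spatialNorm_sq]
    simp [y₀]
    ring
  have hR : max (Kerr.rPlus M' a') 0 + 1 ≤ Kerr.radius a' y₀ := by
    refine freezing_le_radius_of_sq_le (by positivity) ?_
    rw [hsq, hs]
    nlinarith [abs_nonneg a', sq_abs a']
  linarith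

variable {Λ c M' a'}

/-- Rest-frame coordinates of the boosted image `c + Λz` are `z`. [folklore] -/
theorem freezing_poincareInv_boost (z : E4) :
    poincareInv Λ c (c + (Λ : E4 ≃L[ℝ] E4) z) = z := by
  simp [poincareInv]

/-- The boosted image of a rest-frame point of the reference exterior lies in the boosted exterior.
[folklore] -/
theorem freezing_boost_mem_exterior {z : E4} (hz : max (Kerr.rPlus M' a') 0 < Kerr.radius a' z) :
    c + (Λ : E4 ≃L[ℝ] E4) z ∈ (boostedKerrExterior Λ c M' a' : Set E4) := by
  rw [SetLike.mem_coe, mem_boostedKerrExterior, freezing_poincareInv_boost, Kerr.mem_exterior]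
  exact hz

/-- **Injectivity of the boosted family at the anchor**: if `y₀` is an anchor (`y₀ 1 = 0`,
`y₀ 2, y₀ 3 ≠ 0`) then `p ↦ boostedKerrBilin Λ c p.1 p.2 (c + Λy₀)` is injective on `{M > 0}`
(`stub_kerrSchildRigidity` (i), undoing the boost). [cite: KerrSchild1965, §2] -/
theorem freezing_anchor_injective {y₀ : E4} (h1 : y₀ 1 = 0) (h2 : y₀ 2 ≠ 0) (h3 : y₀ 3 ≠ 0)
    {p q : ℝ × ℝ} (hp : 0 < p.1) (hq : 0 < q.1)
    (h : boostedKerrBilin Λ c p.1 p.2 (c + (Λ : E4 ≃L[ℝ] E4) y₀) =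
      boostedKerrBilin Λ c q.1 q.2 (c + (Λ : E4 ≃L[ℝ] E4) y₀)) : p = q := by
  have hK : Kerr.bilin p.1 p.2 y₀ = Kerr.bilin q.1 q.2 y₀ := by
    ext v w
    have := congrArg (fun G : E4 →L[ℝ] E4 →L[ℝ] ℝ ↦ G ((Λ : E4 ≃L[ℝ] E4) v) ((Λ : E4 ≃L[ℝ] E4) w)) h
    simpa [boostedKerrBilin_apply, freezing_poincareInv_boost] using this
  obtain ⟨hM, ha⟩ := kerrSchildRigidity_injective y₀ h1 h2 h3 p.1 p.2 q.1 q.2 hp hq hK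
  exact Prod.ext hM ha

-- the algebraic and the operator-norm instance paths on `E4 →L[ℝ] E4 →L[ℝ] ℝ` unify slowly
set_option synthInstance.maxHeartbeats 200000 in
set_option maxHeartbeats 800000 in
/-- **Continuity of the boosted family in the parameters at a point off every disc** (from the
joint smoothness `dyadicCapture_contDiffAt_boostedKerrBilin₃`). [cite: KerrSchild1965, §3] -/
theorem freezing_continuous_boosted_param {x : E4} (hx : ∀ α : ℝ, 0 < Kerr.radius α (poincareInv Λ c x)) :
    Continuous (fun p : ℝ × ℝ ↦ boostedKerrBilin Λ c p.1 p.2 x) := by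
  refine continuous_iff_continuousAt.2 fun p ↦ ?_
  have hj := (dyadicCapture_contDiffAt_boostedKerrBilin₃ Λ c (q := (p, x)) (n := 0) (hx p.2)).continuousAt
  have h2 : ContinuousAt (fun p' : ℝ × ℝ ↦ ((p', x) : (ℝ × ℝ) × E4)) p :=
    continuousAt_id.prodMk continuousAt_const
  have hcomp : ContinuousAt ((fun q : (ℝ × ℝ) × E4 ↦ boostedKerrBilin Λ c q.1.1 q.1.2 q.2) ∘
      fun p' : ℝ × ℝ ↦ ((p', x) : (ℝ × ℝ) × E4)) p :=
    ContinuousAt.comp (f := fun p' : ℝ × ℝ ↦ ((p', x) : (ℝ × ℝ) × E4)) (x := p) hj h2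
  exact hcomp

/-- The window `{m₀ ≤ M ≤ 1/m₀, |a| ≤ χM}` is compact. [folklore] -/
theorem freezing_isCompact_window (m₀ χ : ℝ) :
    IsCompact {p : ℝ × ℝ | m₀ ≤ p.1 ∧ p.1 ≤ m₀⁻¹ ∧ |p.2| ≤ χ * p.1} := by
  have hc : IsClosed {p : ℝ × ℝ | m₀ ≤ p.1 ∧ p.1 ≤ m₀⁻¹ ∧ |p.2| ≤ χ * p.1} :=
    (isClosed_le continuous_const continuous_fst).inter
      ((isClosed_le continuous_fst continuous_const).inter
        (isClosed_le (continuous_abs.comp continuous_snd) (continuous_const.mul continuous_fst)))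
  set T : ℝ := |χ| * max |m₀| |m₀⁻¹|
  refine ((isCompact_Icc (a := m₀) (b := m₀⁻¹)).prod
    (isCompact_Icc (a := -T) (b := T))).of_isClosed_subset hc ?_
  rintro ⟨M, α⟩ ⟨hM1, hM2, hα⟩
  refine ⟨⟨hM1, hM2⟩, abs_le.1 ?_⟩
  calc |α| ≤ χ * M := hα
    _ ≤ |χ * M| := le_abs_self _
    _ = |χ| * |M| := abs_mul _ _
    _ ≤ |χ| * max |m₀| |m₀⁻¹| :=
        mul_le_mul_of_nonneg_left (abs_le_max_abs_abs hM1 hM2) (abs_nonneg _)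

/-- **Window sequences whose anchor images converge do converge**: `p n` in the (compact) window,
`g_{p n}(c + Λy₀) → L` ⟹ `p n → pinf` for some `pinf` in the window with `g_{pinf}(c + Λy₀) = L`
(compactness, continuity and injectivity at the anchor; `tendsto_of_subseq_tendsto`). [folklore] -/
theorem freezing_tendsto_of_tendsto_anchor {m₀ χ : ℝ} (hm₀ : 0 < m₀) {y₀ : E4} (h1 : y₀ 1 = 0)
    (h2 : y₀ 2 ≠ 0) (h3 : y₀ 3 ≠ 0) {p : ℕ → ℝ × ℝ}
    (hp : ∀ n, p n ∈ {q : ℝ × ℝ | m₀ ≤ q.1 ∧ q.1 ≤ m₀⁻¹ ∧ |q.2| ≤ χ * q.1})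
    {L : E4 →L[ℝ] E4 →L[ℝ] ℝ}
    (hL : Tendsto (fun n ↦ boostedKerrBilin Λ c (p n).1 (p n).2 (c + (Λ : E4 ≃L[ℝ] E4) y₀)) atTop (𝓝 L)) :
    ∃ pinf ∈ {q : ℝ × ℝ | m₀ ≤ q.1 ∧ q.1 ≤ m₀⁻¹ ∧ |q.2| ≤ χ * q.1},
      Tendsto p atTop (𝓝 pinf) ∧ boostedKerrBilin Λ c pinf.1 pinf.2 (c + (Λ : E4 ≃L[ℝ] E4) y₀) = L := by
  set W := {q : ℝ × ℝ | m₀ ≤ q.1 ∧ q.1 ≤ m₀⁻¹ ∧ |q.2| ≤ χ * q.1} with hW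
  set G : ℝ × ℝ → E4 →L[ℝ] E4 →L[ℝ] ℝ :=
    fun q ↦ boostedKerrBilin Λ c q.1 q.2 (c + (Λ : E4 ≃L[ℝ] E4) y₀) with hG
  have hWc : IsCompact W := freezing_isCompact_window m₀ χ
  have hGc : Continuous G := by
    refine freezing_continuous_boosted_param fun α ↦ ?_
    rw [freezing_poincareInv_boost]
    exact kerrSchildRigidity_radius_pos α h3
  have hpos : ∀ q ∈ W, 0 < q.1 := fun q hq ↦ hm₀.trans_le hq.1
  -- the limit of any convergent subsequence has image `L`
  have hlim : ∀ {q : ℝ × ℝ} {φ : ℕ → ℕ}, StrictMono φ → Tendsto (p ∘ φ) atTop (𝓝 q) → G q = L := by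
    intro q φ hφ hq
    have h1 : Tendsto (G ∘ p ∘ φ) atTop (𝓝 (G q)) := (hGc.tendsto q).comp hq
    have h2 : Tendsto (G ∘ p ∘ φ) atTop (𝓝 L) := hL.comp hφ.tendsto_atTop
    exact tendsto_nhds_unique h1 h2
  obtain ⟨pinf, hpinfW, φ, hφ, hφt⟩ := hWc.tendsto_subseq hp
  have hGpinf : G pinf = L := hlim hφ hφt
  refine ⟨pinf, hpinfW, ?_, hGpinf⟩
  refine tendsto_of_subseq_tendsto fun ns hns ↦ ?_
  obtain ⟨q, hqW, ms, hms, hqt⟩ := hWc.tendsto_subseq (x := p ∘ ns) fun n ↦ hp (ns n)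
  have hGq : G q = L := by
    have h1 : Tendsto (G ∘ (p ∘ ns) ∘ ms) atTop (𝓝 (G q)) := (hGc.tendsto q).comp hqt
    have h2 : Tendsto (G ∘ (p ∘ ns) ∘ ms) atTop (𝓝 L) :=
      hL.comp (hns.comp hms.tendsto_atTop)
    exact tendsto_nhds_unique h1 h2
  have hq : q = pinf :=
    freezing_anchor_injective h1 h2 h3 (hpos q hqW) (hpos pinf hpinfW) (hGq.trans hGpinf.symm)
  exact ⟨ms, hq ▸ hqt⟩

end Anchor

/-! ### Anchor translates: consecutive members are close where the deviations are small -/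

section AnchorValues

variable {𝓢 : Spacetime.{0} 4} (Λ : lorentzGroup) (c : E4) (M' a' : ℝ)
  (Ψ : (boostedKerrExterior Λ c M' a') → 𝓢.carrier)

/-- **Two members differ at the anchor by at most the two deviations at any time-translate**:
for `x₀ = c + Λy₀` in the reference exterior and `x = x₀ + τΛe₀`,
`‖g_p(x₀) − g_q(x₀)‖ ≤ ‖(Ψ^*g − g_p)(x)‖ + ‖(Ψ^*g − g_q)(x)‖` (values only, no smoothness needed:
`freezing_deviationExtend_sub` and stationarity `boostedKerrBilin_add_smul`). [cite: KerrSchild1965, §2] -/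
theorem freezing_enorm_anchor_sub_le {x₀ : E4} (hx₀ : x₀ ∈ (boostedKerrExterior Λ c M' a' : Set E4))
    (p q : ℝ × ℝ) (τ : ℝ) :
    ‖boostedKerrBilin Λ c p.1 p.2 x₀ - boostedKerrBilin Λ c q.1 q.2 x₀‖ₑ ≤
      ‖𝓢.deviationExtend ({boostedKerrBackground Λ c M' a' with bilin := boostedKerrBilin Λ c p.1 p.2} :
          ModelBackground) Ψ (x₀ + τ • (Λ : E4 ≃L[ℝ] E4) (EuclideanSpace.single (0 : Fin 4) (1 : ℝ)))‖ₑ +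
      ‖𝓢.deviationExtend ({boostedKerrBackground Λ c M' a' with bilin := boostedKerrBilin Λ c q.1 q.2} :
          ModelBackground) Ψ (x₀ + τ • (Λ : E4 ≃L[ℝ] E4) (EuclideanSpace.single (0 : Fin 4) (1 : ℝ)))‖ₑ := by
  set x := x₀ + τ • (Λ : E4 ≃L[ℝ] E4) (EuclideanSpace.single (0 : Fin 4) (1 : ℝ)) with hx
  have hxU : x ∈ (boostedKerrExterior Λ c M' a' : Set E4) := freezing_add_smul_mem_exterior Λ c M' a' hx₀ τ
  have hsub := freezing_deviationExtend_sub (𝓢 := 𝓢) (boostedKerrBackground Λ c M' a') Ψ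
    (boostedKerrBilin Λ c p.1 p.2) (boostedKerrBilin Λ c q.1 q.2) x
  rw [Set.indicator_of_mem (show x ∈ ((boostedKerrBackground Λ c M' a').domain : Set E4) from hxU)] at hsub
  have hst : boostedKerrBilin Λ c q.1 q.2 x - boostedKerrBilin Λ c p.1 p.2 x =
      boostedKerrBilin Λ c q.1 q.2 x₀ - boostedKerrBilin Λ c p.1 p.2 x₀ := by
    rw [hx, KerrSchildChart.boostedKerrBilin_add_smul, KerrSchildChart.boostedKerrBilin_add_smul]
  rw [hst] at hsub
  have key : boostedKerrBilin Λ c p.1 p.2 x₀ - boostedKerrBilin Λ c q.1 q.2 x₀ =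
      -(𝓢.deviationExtend ({boostedKerrBackground Λ c M' a' with bilin := boostedKerrBilin Λ c p.1 p.2} :
          ModelBackground) Ψ x -
        𝓢.deviationExtend ({boostedKerrBackground Λ c M' a' with bilin := boostedKerrBilin Λ c q.1 q.2} :
          ModelBackground) Ψ x) := by
    rw [hsub]; abel
  rw [key]
  set A := 𝓢.deviationExtend ({boostedKerrBackground Λ c M' a' with bilin := boostedKerrBilin Λ c p.1 p.2} :
      ModelBackground) Ψ x with hA
  set A' := 𝓢.deviationExtend ({boostedKerrBackground Λ c M' a' with bilin := boostedKerrBilin Λ c q.1 q.2} :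
      ModelBackground) Ψ x with hA'
  calc ‖-(A - A')‖ₑ = ‖A - A'‖ₑ := enorm_neg (A - A')
    _ ≤ ‖A‖ₑ + ‖A'‖ₑ := enorm_sub_le

end AnchorValues

/-! ### Disc exclusion: members with finite distance keep their ring out of the reference exterior -/

section Disc

variable {𝓢 : Spacetime.{0} 4} (Λ : lorentzGroup) (c : E4) (M' a' : ℝ)
  (Ψ : (boostedKerrExterior Λ c M' a') → 𝓢.carrier)

/-- A lower bound for the operator norm of a bilinear form by one diagonal value. [folklore] -/
theorem freezing_abs_apply_le_norm_mul (G : E4 →L[ℝ] E4 →L[ℝ] ℝ) (v : E4) :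
    |G v v| ≤ ‖G‖ * (‖v‖ * ‖v‖) := by
  calc |G v v| = ‖G v v‖ := (Real.norm_eq_abs _).symm
    _ ≤ ‖G v‖ * ‖v‖ := (G v).le_opNorm v
    _ ≤ ‖G‖ * ‖v‖ * ‖v‖ := mul_le_mul_of_nonneg_right (G.le_opNorm v) (norm_nonneg _)
    _ = ‖G‖ * (‖v‖ * ‖v‖) := mul_assoc _ _ _

-- the algebraic and the operator-norm instance paths on `E4 →L[ℝ] E4 →L[ℝ] ℝ` unify slowly
set_option synthInstance.maxHeartbeats 200000 in
set_option maxHeartbeats 800000 in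
/-- The `(Λe₀, Λe₀)` component of a boosted member is `−1 + 2H` at the rest-frame point
(`kerrSchildRigidity_components`). [cite: arXiv07060622, (32)] -/
theorem freezing_boosted_apply_e₀ (M a : ℝ) (x : E4) :
    boostedKerrBilin Λ c M a x ((Λ : E4 ≃L[ℝ] E4) (E4.basisVector 0)) ((Λ : E4 ≃L[ℝ] E4) (E4.basisVector 0)) =
      -1 + 2 * Kerr.scalarH M a (poincareInv Λ c x) := by
  have h := (kerrSchildRigidity_components M a (poincareInv Λ c x)).1
  rw [← h, boostedKerrBilin_apply]
  simp only [ContinuousLinearEquiv.symm_apply_apply]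

-- long elementary proof; the algebraic / operator-norm instance paths on `E4 →L[ℝ] E4 →L[ℝ] ℝ` unify slowly
set_option synthInstance.maxHeartbeats 200000 in
set_option maxHeartbeats 1600000 in
/-- **Disc exclusion.** Let `p = (M, a)` with `M > 0`, `|a| ≤ A`, and let `ρ ≥ A + 1`. If the `Cᵏ`
distance `truncDeviationCk` of the smooth chart `Ψ` from `g_p` on the reference slab
`{t* = τ, r_{a'} ≤ ρ}` is finite, then `a² ≤ a'² + max(r₊', 0)²`. Otherwise the ring
`{t* = τ, z = 0, x₁² + x₂² = a²}` of `g_p` lies in the reference exterior and inside the slab; near it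
the pulled-back metric `Ψ^*g` is bounded (it is continuous on the open domain, being
`(Ψ^*g − g_{M,0}) + g_{M,0}` with both terms smooth there) while `g_p(Λe₀, Λe₀) = −1 + 2H`, `H = M/r`,
is unbounded (`stub_kerrSchildRigidity` (iii)) — so the deviation is unbounded on the slab.
[cite: arXiv07060622, (33)–(35)] -/
theorem freezing_sq_le_of_truncDeviationCk_ne_top (hΨ : ContMDiff 𝓘(ℝ, E4) (𝓡 4) ∞ Ψ)
    {p : ℝ × ℝ} (hM : 0 < p.1) {A ρ : ℝ} (hA : |p.2| ≤ A) (hρ : A + 1 ≤ ρ) {k : ℕ} {τ : ℝ}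
    (hfin : 𝓢.truncDeviationCk ({boostedKerrBackground Λ c M' a' with
        bilin := boostedKerrBilin Λ c p.1 p.2} : ModelBackground) Ψ k ρ τ ≠ ⊤) :
    p.2 ^ 2 ≤ a' ^ 2 + max (Kerr.rPlus M' a') 0 ^ 2 := by
  by_contra hgt
  push Not at hgt
  set α : ℝ := p.2 with hα
  have hm0 : 0 ≤ max (Kerr.rPlus M' a') 0 := le_max_right _ _
  have hα0 : α ≠ 0 := by
    intro h0
    rw [h0] at hgt
    nlinarith [sq_nonneg a']
  -- the ring point `z* = τ e₀ + α e₁` and its boosted image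
  set z : E4 := τ • E4.basisVector 0 + α • E4.basisVector 1 with hz
  have hz0 : z 0 = τ := by simp [hz, E4.basisVector]
  have hz1 : z 1 = α := by simp [hz, E4.basisVector]
  have hz2 : z 2 = 0 := by simp [hz, E4.basisVector]
  have hz3 : z 3 = 0 := by simp [hz, E4.basisVector]
  have hzn : E4.spatialNorm z ^ 2 = α ^ 2 := by rw [E4.spatialNorm_sq, hz1, hz2, hz3]; ring
  have hring : z 1 ^ 2 + z 2 ^ 2 = α ^ 2 := by rw [hz1, hz2]; ring
  have hrz : max (Kerr.rPlus M' a') 0 < Kerr.radius a' z := by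
    have hsq := freezing_radius_sq_of_three_eq_zero a' hz3
    rw [hzn] at hsq
    have h1 : max (Kerr.rPlus M' a') 0 ^ 2 < Kerr.radius a' z ^ 2 := by
      rw [hsq]; exact lt_max_of_lt_left (by linarith)
    exact (pow_lt_pow_iff_left₀ hm0 (Kerr.radius_nonneg a' z) two_ne_zero).1 h1
  set x : E4 := c + (Λ : E4 ≃L[ℝ] E4) z with hx
  have hxz : poincareInv Λ c x = z := freezing_poincareInv_boost z
  have hxU : x ∈ (boostedKerrExterior Λ c M' a' : Set E4) := freezing_boost_mem_exterior hrz
  -- the comparison member `(M, 0)` is smooth at `x` (its radius there is `|α| > 0`)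
  set q : ℝ × ℝ := (p.1, 0) with hq
  have hq0 : ∀ {y : E4}, E4.spatialNorm (poincareInv Λ c y) ≠ 0 → 0 < Kerr.radius q.2 (poincareInv Λ c y) := by
    intro y hy
    rw [show q.2 = 0 from rfl, Kerr.radius_zero_left]
    exact lt_of_le_of_ne (E4.spatialNorm_nonneg _) (Ne.symm hy)
  have hxq : 0 < Kerr.radius q.2 (poincareInv Λ c x) := by
    refine hq0 ?_
    rw [hxz]
    intro h0
    have : α ^ 2 = 0 := by rw [← hzn, h0]; ring
    exact hα0 (pow_eq_zero_iff two_ne_zero |>.1 this)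
  set B : ModelBackground := boostedKerrBackground Λ c M' a' with hB
  set Fq := 𝓢.deviationExtend ({B with bilin := boostedKerrBilin Λ c q.1 q.2} : ModelBackground) Ψ with hFq
  set Fp := 𝓢.deviationExtend ({B with bilin := boostedKerrBilin Λ c p.1 p.2} : ModelBackground) Ψ with hFp
  set Gq := boostedKerrBilin Λ c q.1 q.2 with hGq
  set Gp := boostedKerrBilin Λ c p.1 p.2 with hGp
  have hFqc := Filter.Tendsto.norm (E := E4 →L[ℝ] E4 →L[ℝ] ℝ)
    ((freezing_contDiffAt_deviationExtend B Ψ Gq hΨ hxU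
      (freezing_contDiffAt_boosted Λ c q hxq)).continuousAt.tendsto)
  have hGqc := Filter.Tendsto.norm (E := E4 →L[ℝ] E4 →L[ℝ] ℝ)
    ((freezing_contDiffAt_boosted Λ c q hxq).continuousAt.tendsto)
  -- neighbourhoods where `Fq` and `Gq` are bounded by their value at `x` plus one
  obtain ⟨V₁, hV₁, hbF⟩ : ∃ V₁ ∈ 𝓝 x, ∀ y ∈ V₁, ‖Fq y‖ ≤ ‖Fq x‖ + 1 := by
    have hev : ∀ᶠ y in 𝓝 x, ‖Fq y‖ ≤ ‖Fq x‖ + 1 := hFqc.eventually_le_const (by linarith)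
    exact ⟨_, hev, fun y hy ↦ hy⟩
  obtain ⟨V₂, hV₂, hbG⟩ : ∃ V₂ ∈ 𝓝 x, ∀ y ∈ V₂, ‖Gq y‖ ≤ ‖Gq x‖ + 1 := by
    have hev : ∀ᶠ y in 𝓝 x, ‖Gq y‖ ≤ ‖Gq x‖ + 1 := hGqc.eventually_le_const (by linarith)
    exact ⟨_, hev, fun y hy ↦ hy⟩
  set K : ℝ := ‖Fq x‖ + ‖Gq x‖ + 2 with hK
  -- on `V₁ ∩ V₂ ∩ U` the member `g_p` is bounded by `K + ‖Fp‖`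
  have hGp_le : ∀ y ∈ V₁ ∩ V₂, y ∈ (boostedKerrExterior Λ c M' a' : Set E4) → ‖Gp y‖ ≤ K + ‖Fp y‖ := by
    intro y hy hyU
    have hsub := freezing_deviationExtend_sub (𝓢 := 𝓢) B Ψ Gp Gq y
    rw [Set.indicator_of_mem (show y ∈ (B.domain : Set E4) from hyU)] at hsub
    have : Gp y = Gq y - (Fp y - Fq y) := by rw [hsub]; abel
    rw [this]
    calc ‖Gq y - (Fp y - Fq y)‖ ≤ ‖Gq y‖ + ‖Fp y - Fq y‖ := norm_sub_le (Gq y) (Fp y - Fq y)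
      _ ≤ ‖Gq y‖ + (‖Fp y‖ + ‖Fq y‖) := by gcongr; exact norm_sub_le (Fp y) (Fq y)
      _ ≤ (‖Gq x‖ + 1) + (‖Fp y‖ + (‖Fq x‖ + 1)) := by
          gcongr
          · exact hbG y hy.2
          · exact hbF y hy.1
      _ = K + ‖Fp y‖ := by rw [hK]; ring
  -- the finite slab distance bounds `Fp` on the slab
  set D := 𝓢.truncDeviationCk ({B with bilin := Gp} : ModelBackground) Ψ k ρ τ with hD
  have hFp_le : ∀ y ∈ Subtype.val '' ({B with bilin := Gp} : ModelBackground).truncTimeSlab ρ τ,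
      ‖Fp y‖ ≤ D.toReal := by
    intro y hy
    have h1 : ‖iteratedFDeriv ℝ 0 Fp y‖ₑ ≤ D :=
      freezing_enorm_iteratedFDeriv_le_truncDeviationCk (𝓢 := 𝓢) B Ψ Gp (Nat.zero_le k) hy
    have h2 := ENNReal.toReal_mono hfin h1
    rwa [toReal_enorm, norm_iteratedFDeriv_zero] at h2
  have hK2 : 2 ≤ K := by rw [hK]; linarith [norm_nonneg (Fq x), norm_nonneg (Gq x)]
  have hD0 : 0 ≤ D.toReal := ENNReal.toReal_nonneg
  -- the blow-up radius bound: `C` with `2C − 1 > ‖Λe₀‖² (K + D + 1)`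
  set v : E4 := (Λ : E4 ≃L[ℝ] E4) (E4.basisVector 0) with hv
  have hv0 : v ≠ 0 := by
    rw [hv]
    intro h0
    have := (Λ : E4 ≃L[ℝ] E4).injective (h0.trans (map_zero _).symm)
    have h00 := congrArg (fun w : E4 ↦ w 0) this
    simp [E4.basisVector] at h00
  have hvv : 0 < ‖v‖ * ‖v‖ := by positivity
  set C : ℝ := (‖v‖ * ‖v‖ * (K + D.toReal + 1) + 1) / 2 + 1 with hC
  -- the rest-frame neighbourhood of the ring point in which the blow-up point is sought
  set φ : E4 → E4 := fun w ↦ c + (Λ : E4 ≃L[ℝ] E4) w with hφ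
  have hφc : Continuous φ := continuous_const.add (Λ : E4 ≃L[ℝ] E4).continuous
  have hφz : φ z = x := rfl
  have hN : φ ⁻¹' (V₁ ∩ V₂ ∩ (boostedKerrExterior Λ c M' a' : Set E4)) ∩
      {w : E4 | Kerr.radius a' w < ρ} ∈ 𝓝 z := by
    refine inter_mem ?_ ?_
    · refine hφc.continuousAt.preimage_mem_nhds ?_
      rw [hφz]
      exact inter_mem (inter_mem hV₁ hV₂) ((boostedKerrExterior Λ c M' a').2.mem_nhds hxU)
    · refine (isOpen_lt (Kerr.continuous_radius a') continuous_const).mem_nhds ?_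
      show Kerr.radius a' z < ρ
      have h1 : Kerr.radius a' z ≤ E4.spatialNorm z := Kerr.radius_le_spatialNorm a' z
      have h2 : E4.spatialNorm z = |α| := by
        have := hzn
        rw [← sq_abs α] at this
        exact (sq_eq_sq₀ (E4.spatialNorm_nonneg z) (abs_nonneg α)).1 this
      linarith
  obtain ⟨w, hw, hw0, hwr, hwC⟩ :=
    kerrSchildRigidity_blowup p.1 α hM z hz3 hring C _ hN
  obtain ⟨⟨⟨hw1, hw2⟩, hwU⟩, hwρ⟩ := hw
  -- the blow-up point, boosted
  set y : E4 := φ w with hy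
  have hyw : poincareInv Λ c y = w := freezing_poincareInv_boost w
  have hyU : y ∈ (boostedKerrExterior Λ c M' a' : Set E4) := hwU
  have hyslab : y ∈ Subtype.val '' ({B with bilin := Gp} : ModelBackground).truncTimeSlab ρ τ := by
    rw [hB, freezing_mem_slab_iff]
    refine ⟨hyU, ?_, ?_⟩
    · rw [hyw, hw0, hz0]
    · rw [hyw]; exact hwρ.le
  -- upper bound
  have hup : ‖Gp y‖ ≤ K + D.toReal := (hGp_le y ⟨hw1, hw2⟩ hyU).trans (by linarith [hFp_le y hyslab])
  -- lower bound from the `(Λe₀, Λe₀)` component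
  have hcomp : Gp y v v = -1 + 2 * Kerr.scalarH p.1 α w := by
    rw [hGp, hv, freezing_boosted_apply_e₀, hyw]
  have h2C : 2 * C - 1 = ‖v‖ * ‖v‖ * (K + D.toReal + 1) + 2 := by rw [hC]; ring
  have hC1 : 1 ≤ C := by
    rw [hC]
    have : 0 ≤ ‖v‖ * ‖v‖ * (K + D.toReal + 1) := by positivity
    linarith
  have hlow : 2 * C - 1 ≤ ‖Gp y‖ * (‖v‖ * ‖v‖) := by
    have h1 := freezing_abs_apply_le_norm_mul (Gp y) v
    rw [hcomp] at h1
    have h2 : 2 * C - 1 ≤ |-1 + 2 * Kerr.scalarH p.1 α w| := by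
      rw [abs_of_nonneg (by linarith)]
      linarith
    exact h2.trans h1
  have hprod : ‖Gp y‖ * (‖v‖ * ‖v‖) ≤ (K + D.toReal) * (‖v‖ * ‖v‖) :=
    mul_le_mul_of_nonneg_right hup hvv.le
  nlinarith [hlow, hprod, hvv, h2C]

end Disc

/-- **Part B, registered form** (`freezingB_poincareInv_boost`, the name under which this helper file
is attached to the crux item): rest-frame coordinates of the boosted image `c + Λz` are `z`.
[folklore] -/
theorem freezingB_poincareInv_boost : ∀ (Λ : lorentzGroup) (c z : E4), poincareInv Λ c (c + (Λ : E4 ≃L[ℝ] E4) z) = z :=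
  fun _ _ z ↦ freezing_poincareInv_boost z

end Summit.FinalStateConjecture.FinalStateConjecture.Theorems

end
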